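import Summits.RiemannHypothesis.RiemannHypothesis.Theorems.WeilOffLineNoLeverOrder
import HarnessLib

/-!
# Weil's form is the quadratic form of the verified zeros, up to the off-line budget

Structure seat rh-explicit-weil-3 (gen6), supporting `stmt-RiemannHypothesis-0098`; sequel of
`WeilOffLineSplit.lean` / `WeilOffLineNoLever.lean` / `WeilOffLineNoLeverOrder.lean`.  Everything PROVED.
`ĝ = weilMellin g`, `Q = weilQuadratic`, `m = riemannZetaZeroOrder`, `C_g = weilDecayConst g`,
`L_k(g) = weilL1 (deriv^[k] g)`.

The VERIFIED-ZERO FORM of height `T₀` is the series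
`S_{T₀}(g) = ∑_{ρ : |Im ρ| ≤ T₀} m(ρ) ‖ĝ(ρ)‖²` (written as a `tsum` of `if |Im ρ| ≤ T₀ then … else 0`;
a finite sum of `m(ρ)|ĝ(½+iγ)|²` over the zeros up to height `T₀` when these lie on the line).

* `abs_re_weilQuadratic_sub_verified_le` — **if every non-trivial zero with `|Im ρ| ≤ T₀` (`T₀ ≥ 0`)
  lies on the critical line, then for EVERY test function
  `|Re Q(g) − S_{T₀}(g)| ≤ (463/10000) · C_g²/(1 + T₀²)`**: above the verified height the line series
  and the off-line series are each at most `(C_g²/(1+T₀²)) ∑ m/|ρ|² ≤ 0.0463 C_g²/(1+T₀²)` and they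
  enter with opposite signs.
* `abs_re_weilQuadratic_sub_verified_le_order` — to every order `k ≥ 1` (`T₀ ≥ 1`):
  `|Re Q(g) − S_{T₀}(g)| ≤ (463/5000) · L_k(g)² · T₀²/T₀^{2k}`.
* `abs_re_weilQuadratic_sub_verified_plattTrudgian` — at `T₀ = 3 000 175 332 800` (Platt–Trudgian
  height, inlined hypothesis as in `WeilAdversary.AdversaryTransfer`): `|Re Q(g) − S_{T₀}(g)| ≤ (52/10²⁸) C_g²`.

Reading: conditionally only on a verified height, Weil's quadratic form of ANY test function IS the
explicit positive quadratic form of the finitely many verified zeros, to `26` digits in units of `C_g²`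
(to `24(k−1)` digits in units of `L_k²`): the certified margins of the support-extension ladder are
minima of `S_{T₀}(g)/‖g‖²` over the window to every shown digit, i.e. functionals of the KNOWN zeros;
whatever lies above `T₀` (on or off the line) is invisible at that precision.
-/

noncomputable section

set_option linter.dupNamespace false  -- the mandated namespace repeats `RiemannHypothesis`

open Complex Filter Set MeasureTheory Topology
open scoped Real ComplexConjugate

namespace Summit.RiemannHypothesis.RiemannHypothesis.Theorems.WeilOffLine

open Literature.NumberTheory.LFunctions Literature.NumberTheory.LFunctions.WeilConverse

/-! ### The verified-zero form and the line series -/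

/-- The verified-zero series converges (its terms are `≤ m(ρ)‖ĝ(ρ)‖² ≤ m C_g²/(1+γ²)²`). [folklore] -/
theorem summable_verified {g : ℝ → ℂ} (hg : IsWeilTest g) (T₀ : ℝ) :
    Summable fun ρ : ZetaZeros.riemannZetaNontrivialZeros ↦
      if |(ρ : ℂ).im| ≤ T₀ then (riemannZetaZeroOrder (ρ : ℂ) : ℝ) * ‖weilMellin g ρ‖ ^ 2 else 0 := by
  have hS : Summable fun ρ : ZetaZeros.riemannZetaNontrivialZeros ↦
      (riemannZetaZeroOrder (ρ : ℂ) : ℝ) * ‖weilMellin g ρ‖ ^ 2 := by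
    refine summable_zeroOrder_mul_of_le (x := fun ρ ↦ ‖weilMellin g ρ‖ ^ 2)
      (K := weilDecayConst g ^ 2) (fun ρ _ ↦ sq_nonneg _) fun ρ hρ ↦ ?_
    have h := norm_weilMellin_le hg (ZetaZeros.riemannZetaNontrivialZeros.re_pos hρ).le
      (ZetaZeros.riemannZetaNontrivialZeros.re_lt_one hρ).le
    calc ‖weilMellin g ρ‖ ^ 2 ≤ (weilDecayConst g / (1 + ρ.im ^ 2)) ^ 2 :=
          pow_le_pow_left₀ (norm_nonneg _) h 2
      _ = weilDecayConst g ^ 2 / (1 + ρ.im ^ 2) ^ 2 := by rw [div_pow]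
  have hm : ∀ ρ : ZetaZeros.riemannZetaNontrivialZeros, (0 : ℝ) ≤ riemannZetaZeroOrder (ρ : ℂ) :=
    fun ρ ↦ by exact_mod_cast riemannZetaZeroOrder_nonneg (ZetaZeros.riemannZetaNontrivialZeros.ne_one ρ.2)
  refine hS.of_nonneg_of_le (fun ρ ↦ ?_) (fun ρ ↦ ?_)
  · split_ifs
    · exact mul_nonneg (hm ρ) (sq_nonneg _)
    · exact le_rfl
  · split_ifs
    · exact le_rfl
    · exact mul_nonneg (hm ρ) (sq_nonneg _)

/-- Termwise comparison of the line series with the verified-zero form above a verified height: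
`low(ρ) ≤ m‖(ĝ(ρ)+ĝ(1−ρ̄))/2‖² ≤ low(ρ) + (C_g²/(1+T₀²)) m(ρ)/|ρ|²`, where `low(ρ) = m‖ĝ(ρ)‖²` below
the height (there `ĝ(1−ρ̄) = ĝ(ρ)`) and `0` above. [folklore] -/
theorem line_term_between_of_rh_upTo {g : ℝ → ℂ} (hg : IsWeilTest g) {T₀ : ℝ} (hT₀ : 0 ≤ T₀)
    (hRH : ∀ ρ ∈ ZetaZeros.riemannZetaNontrivialZeros, |ρ.im| ≤ T₀ → ρ.re = 1 / 2)
    (ρ : ZetaZeros.riemannZetaNontrivialZeros) :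
    (if |(ρ : ℂ).im| ≤ T₀ then (riemannZetaZeroOrder (ρ : ℂ) : ℝ) * ‖weilMellin g ρ‖ ^ 2 else 0) ≤
        (riemannZetaZeroOrder (ρ : ℂ) : ℝ) *
          ‖(weilMellin g ρ + weilMellin g (1 - conj (ρ : ℂ))) / 2‖ ^ 2 ∧
      (riemannZetaZeroOrder (ρ : ℂ) : ℝ) *
          ‖(weilMellin g ρ + weilMellin g (1 - conj (ρ : ℂ))) / 2‖ ^ 2 ≤
        (if |(ρ : ℂ).im| ≤ T₀ then (riemannZetaZeroOrder (ρ : ℂ) : ℝ) * ‖weilMellin g ρ‖ ^ 2 else 0) +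
          weilDecayConst g ^ 2 / (1 + T₀ ^ 2) *
            ((riemannZetaZeroOrder (ρ : ℂ) : ℝ) / ‖(ρ : ℂ)‖ ^ 2) := by
  have hm : (0 : ℝ) ≤ riemannZetaZeroOrder (ρ : ℂ) := by
    exact_mod_cast riemannZetaZeroOrder_nonneg (ZetaZeros.riemannZetaNontrivialZeros.ne_one ρ.2)
  have h0 := ZetaZeros.riemannZetaNontrivialZeros.re_pos ρ.2
  have h1 := ZetaZeros.riemannZetaNontrivialZeros.re_lt_one ρ.2
  have hρ0 : 0 < ‖(ρ : ℂ)‖ ^ 2 := by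
    have : (ρ : ℂ) ≠ 0 := fun h ↦ by rw [h, Complex.zero_re] at h0; exact lt_irrefl _ h0
    positivity
  have hextra : 0 ≤ weilDecayConst g ^ 2 / (1 + T₀ ^ 2) *
      ((riemannZetaZeroOrder (ρ : ℂ) : ℝ) / ‖(ρ : ℂ)‖ ^ 2) :=
    mul_nonneg (div_nonneg (sq_nonneg _) (by positivity)) (div_nonneg hm hρ0.le)
  by_cases hγ : |(ρ : ℂ).im| ≤ T₀
  · rw [if_pos hγ, weilMellin_add_reflect_eq g (hRH ρ ρ.2 hγ), mul_div_cancel_left₀ _ two_ne_zero]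
    exact ⟨le_rfl, le_add_of_nonneg_right hextra⟩
  · rw [if_neg hγ, zero_add]
    push Not at hγ
    refine ⟨mul_nonneg hm (sq_nonneg _), ?_⟩
    have hD : ‖(weilMellin g ρ + weilMellin g (1 - conj (ρ : ℂ))) / 2‖ ≤
        weilDecayConst g / (1 + (ρ : ℂ).im ^ 2) := by
      have := norm_weilMellin_add_reflect_le_decay hg ρ.2
      rw [norm_div, Complex.norm_ofNat]; linarith
    have hD2 : ‖(weilMellin g ρ + weilMellin g (1 - conj (ρ : ℂ))) / 2‖ ^ 2 ≤
        weilDecayConst g ^ 2 / (1 + (ρ : ℂ).im ^ 2) ^ 2 := by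
      rw [← div_pow]; exact pow_le_pow_left₀ (norm_nonneg _) hD 2
    have hγ2 : T₀ ^ 2 ≤ (ρ : ℂ).im ^ 2 := by
      have := sq_le_sq' (by linarith [abs_nonneg ((ρ : ℂ).im)]) hγ.le
      rwa [sq_abs] at this
    have hnorm : ‖(ρ : ℂ)‖ ^ 2 ≤ 1 + (ρ : ℂ).im ^ 2 := by
      rw [← Complex.normSq_eq_norm_sq, Complex.normSq_apply]
      nlinarith
    have hkey : (1 + T₀ ^ 2) * ‖(ρ : ℂ)‖ ^ 2 ≤ (1 + (ρ : ℂ).im ^ 2) ^ 2 := by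
      calc (1 + T₀ ^ 2) * ‖(ρ : ℂ)‖ ^ 2 ≤ (1 + (ρ : ℂ).im ^ 2) * (1 + (ρ : ℂ).im ^ 2) :=
            mul_le_mul (by linarith) hnorm hρ0.le (by positivity)
        _ = (1 + (ρ : ℂ).im ^ 2) ^ 2 := by ring
    have hfrac : weilDecayConst g ^ 2 / (1 + (ρ : ℂ).im ^ 2) ^ 2 ≤
        weilDecayConst g ^ 2 / (1 + T₀ ^ 2) * (1 / ‖(ρ : ℂ)‖ ^ 2) := by
      rw [div_mul_div_comm, mul_one]
      exact div_le_div_of_nonneg_left (sq_nonneg _) (by positivity) hkey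
    calc (riemannZetaZeroOrder (ρ : ℂ) : ℝ) *
          ‖(weilMellin g ρ + weilMellin g (1 - conj (ρ : ℂ))) / 2‖ ^ 2
        ≤ (riemannZetaZeroOrder (ρ : ℂ) : ℝ) *
            (weilDecayConst g ^ 2 / (1 + T₀ ^ 2) * (1 / ‖(ρ : ℂ)‖ ^ 2)) :=
          mul_le_mul_of_nonneg_left (hD2.trans hfrac) hm
      _ = _ := by ring

/-- **WEIL'S FORM IS THE VERIFIED-ZERO FORM UP TO THE OFF-LINE BUDGET**: if every non-trivial zero
with `|Im ρ| ≤ T₀` (`T₀ ≥ 0`) lies on the line, then for every test function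
`|Re Q(g) − ∑_{|Im ρ| ≤ T₀} m(ρ)‖ĝ(ρ)‖²| ≤ (463/10000) · C_g²/(1 + T₀²)`. [folklore] -/
theorem abs_re_weilQuadratic_sub_verified_le {g : ℝ → ℂ} (hg : IsWeilTest g) {T₀ : ℝ}
    (hT₀ : 0 ≤ T₀)
    (hRH : ∀ ρ ∈ ZetaZeros.riemannZetaNontrivialZeros, |ρ.im| ≤ T₀ → ρ.re = 1 / 2) :
    |(weilQuadratic g).re -
        ∑' ρ : ZetaZeros.riemannZetaNontrivialZeros,
          (if |(ρ : ℂ).im| ≤ T₀ then (riemannZetaZeroOrder (ρ : ℂ) : ℝ) * ‖weilMellin g ρ‖ ^ 2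
            else 0)| ≤
      463 / 10000 * weilDecayConst g ^ 2 / (1 + T₀ ^ 2) := by
  have hsplit := re_weilQuadratic_eq_tsum_sub_tsum hg
  have hV := summable_verified hg T₀
  have hL := summable_line hg
  have hF := FordL33.summable_order_div_norm_sq.mul_left (weilDecayConst g ^ 2 / (1 + T₀ ^ 2))
  -- the line series is squeezed between the verified form and the verified form + tail
  have hlow : ∑' ρ : ZetaZeros.riemannZetaNontrivialZeros,
      (if |(ρ : ℂ).im| ≤ T₀ then (riemannZetaZeroOrder (ρ : ℂ) : ℝ) * ‖weilMellin g ρ‖ ^ 2 else 0) ≤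
      ∑' ρ : ZetaZeros.riemannZetaNontrivialZeros,
        (riemannZetaZeroOrder (ρ : ℂ) : ℝ) *
          ‖(weilMellin g ρ + weilMellin g (1 - conj (ρ : ℂ))) / 2‖ ^ 2 :=
    hV.tsum_le_tsum (fun ρ ↦ (line_term_between_of_rh_upTo hg hT₀ hRH ρ).1) hL
  have hup : ∑' ρ : ZetaZeros.riemannZetaNontrivialZeros,
        (riemannZetaZeroOrder (ρ : ℂ) : ℝ) *
          ‖(weilMellin g ρ + weilMellin g (1 - conj (ρ : ℂ))) / 2‖ ^ 2 ≤
      (∑' ρ : ZetaZeros.riemannZetaNontrivialZeros,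
        (if |(ρ : ℂ).im| ≤ T₀ then (riemannZetaZeroOrder (ρ : ℂ) : ℝ) * ‖weilMellin g ρ‖ ^ 2 else 0)) +
      weilDecayConst g ^ 2 / (1 + T₀ ^ 2) *
        ∑' ρ : ZetaZeros.riemannZetaNontrivialZeros,
          (riemannZetaZeroOrder (ρ : ℂ) : ℝ) / ‖(ρ : ℂ)‖ ^ 2 := by
    rw [← tsum_mul_left, ← hV.tsum_add hF]
    exact hL.tsum_le_tsum (fun ρ ↦ (line_term_between_of_rh_upTo hg hT₀ hRH ρ).2) (hV.add hF)
  have hoff0 := tsum_offLine_nonneg g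
  have hoff := tsum_offLine_le_of_rh_upTo hg hT₀ hRH
  have h3 : ∑' ρ : ZetaZeros.riemannZetaNontrivialZeros,
      (riemannZetaZeroOrder (ρ : ℂ) : ℝ) / ‖(ρ : ℂ)‖ ^ 2 ≤ 0.0463 :=
    tsum_zeroOrder_div_norm_sq_le
  have hC : 0 ≤ weilDecayConst g ^ 2 / (1 + T₀ ^ 2) := div_nonneg (sq_nonneg _) (by positivity)
  have h4 := mul_le_mul_of_nonneg_left h3 hC
  have h5 : weilDecayConst g ^ 2 / (1 + T₀ ^ 2) * 0.0463 =
      463 / 10000 * weilDecayConst g ^ 2 / (1 + T₀ ^ 2) := by ring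
  rw [hsplit, abs_le]
  constructor <;> linarith

/-- **At the Platt–Trudgian height** (inlined hypothesis as in `WeilAdversary.AdversaryTransfer`):
`|Re Q(g) − ∑_{|Im ρ| ≤ T₀} m(ρ)‖ĝ(ρ)‖²| ≤ (52/10²⁸) C_g²`, `T₀ = 3 000 175 332 800`. [folklore] -/
theorem abs_re_weilQuadratic_sub_verified_plattTrudgian
    (h : ∀ s : ℂ, riemannZeta s = 0 → 0 < s.im → s.im ≤ 3000175332800 → s.re = 1 / 2)
    {g : ℝ → ℂ} (hg : IsWeilTest g) :
    |(weilQuadratic g).re -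
        ∑' ρ : ZetaZeros.riemannZetaNontrivialZeros,
          (if |(ρ : ℂ).im| ≤ 3000175332800 then
            (riemannZetaZeroOrder (ρ : ℂ) : ℝ) * ‖weilMellin g ρ‖ ^ 2 else 0)| ≤
      52 / 10 ^ 28 * weilDecayConst g ^ 2 := by
  have h1 := abs_re_weilQuadratic_sub_verified_le hg (T₀ := 3000175332800) (by norm_num)
    (rh_upTo_of_upper h)
  have hC := sq_nonneg (weilDecayConst g)
  have h2 : 463 / 10000 * weilDecayConst g ^ 2 / (1 + (3000175332800 : ℝ) ^ 2) ≤
      52 / 10 ^ 28 * weilDecayConst g ^ 2 := by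
    rw [div_le_iff₀ (by positivity)]
    nlinarith
  exact h1.trans h2

/-! ### To every order -/

/-- The line part from `k` derivatives: `‖(ĝ(ρ) + ĝ(1−ρ̄))/2‖ ≤ L_k(g)/|Im ρ|^k` at a non-trivial zero.
[folklore] -/
theorem norm_line_le_of_iterate_deriv {g : ℝ → ℂ} (hg : IsWeilTest g) (k : ℕ) {ρ : ℂ}
    (hρ : ρ ∈ ZetaZeros.riemannZetaNontrivialZeros) :
    ‖(weilMellin g ρ + weilMellin g (1 - conj ρ)) / 2‖ ≤ weilL1 (deriv^[k] g) / |ρ.im| ^ k := by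
  have h0 := ZetaZeros.riemannZetaNontrivialZeros.re_pos hρ
  have h1 := ZetaZeros.riemannZetaNontrivialZeros.re_lt_one hρ
  have him := ZetaZeros.riemannZetaNontrivialZeros.im_ne_zero hρ
  have ha := norm_weilMellin_le_weilL1_iterate_deriv_div hg k h0.le h1.le him
  have hb : ‖weilMellin g (1 - conj ρ)‖ ≤ weilL1 (deriv^[k] g) / |ρ.im| ^ k := by
    have := norm_weilMellin_le_weilL1_iterate_deriv_div hg k (s := 1 - conj ρ)
      (by rw [one_sub_conj_re]; linarith) (by rw [one_sub_conj_re]; linarith)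
      (by rw [one_sub_conj_im]; exact him)
    rwa [one_sub_conj_im] at this
  rw [norm_div, Complex.norm_ofNat]
  linarith [norm_add_le (weilMellin g ρ) (weilMellin g (1 - conj ρ))]

/-- Termwise, to order `k ≥ 1` (`T₀ ≥ 1`): `m‖(ĝ(ρ)+ĝ(1−ρ̄))/2‖² ≤ low(ρ) + (2 L_k² T₀²/T₀^{2k}) m/|ρ|²`.
[folklore] -/
theorem line_term_le_of_rh_upTo_order {g : ℝ → ℂ} (hg : IsWeilTest g) {k : ℕ} (hk : 1 ≤ k)
    {T₀ : ℝ} (hT₀ : 1 ≤ T₀)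
    (hRH : ∀ ρ ∈ ZetaZeros.riemannZetaNontrivialZeros, |ρ.im| ≤ T₀ → ρ.re = 1 / 2)
    (ρ : ZetaZeros.riemannZetaNontrivialZeros) :
    (riemannZetaZeroOrder (ρ : ℂ) : ℝ) *
        ‖(weilMellin g ρ + weilMellin g (1 - conj (ρ : ℂ))) / 2‖ ^ 2 ≤
      (if |(ρ : ℂ).im| ≤ T₀ then (riemannZetaZeroOrder (ρ : ℂ) : ℝ) * ‖weilMellin g ρ‖ ^ 2 else 0) +
        2 * weilL1 (deriv^[k] g) ^ 2 * T₀ ^ 2 / T₀ ^ (2 * k) *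
          ((riemannZetaZeroOrder (ρ : ℂ) : ℝ) / ‖(ρ : ℂ)‖ ^ 2) := by
  have hm : (0 : ℝ) ≤ riemannZetaZeroOrder (ρ : ℂ) := by
    exact_mod_cast riemannZetaZeroOrder_nonneg (ZetaZeros.riemannZetaNontrivialZeros.ne_one ρ.2)
  have h0 := ZetaZeros.riemannZetaNontrivialZeros.re_pos ρ.2
  have h1 := ZetaZeros.riemannZetaNontrivialZeros.re_lt_one ρ.2
  have hT : 0 < T₀ := by linarith
  have hρ0 : 0 < ‖(ρ : ℂ)‖ ^ 2 := by
    have : (ρ : ℂ) ≠ 0 := fun h ↦ by rw [h, Complex.zero_re] at h0; exact lt_irrefl _ h0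
    positivity
  have hextra : 0 ≤ 2 * weilL1 (deriv^[k] g) ^ 2 * T₀ ^ 2 / T₀ ^ (2 * k) *
      ((riemannZetaZeroOrder (ρ : ℂ) : ℝ) / ‖(ρ : ℂ)‖ ^ 2) :=
    mul_nonneg (div_nonneg (by positivity) (by positivity)) (div_nonneg hm hρ0.le)
  by_cases hγ : |(ρ : ℂ).im| ≤ T₀
  · rw [if_pos hγ, weilMellin_add_reflect_eq g (hRH ρ ρ.2 hγ), mul_div_cancel_left₀ _ two_ne_zero]
    exact le_add_of_nonneg_right hextra
  · rw [if_neg hγ, zero_add]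
    push Not at hγ
    set L := weilL1 (deriv^[k] g) with hL
    have hD := norm_line_le_of_iterate_deriv hg k ρ.2
    have hγpos : 0 < |(ρ : ℂ).im| := by linarith
    have hD2 : ‖(weilMellin g ρ + weilMellin g (1 - conj (ρ : ℂ))) / 2‖ ^ 2 ≤
        L ^ 2 / (|(ρ : ℂ).im| ^ k) ^ 2 := by
      rw [← div_pow]; exact pow_le_pow_left₀ (norm_nonneg _) hD 2
    have hγ1 : 1 ≤ |(ρ : ℂ).im| := hT₀.trans hγ.le
    have him2 : 1 ≤ (ρ : ℂ).im ^ 2 := by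
      have := pow_le_pow_left₀ zero_le_one hγ1 2
      simpa [sq_abs] using this
    have hnorm : ‖(ρ : ℂ)‖ ^ 2 ≤ 2 * |(ρ : ℂ).im| ^ 2 := by
      rw [← Complex.normSq_eq_norm_sq, Complex.normSq_apply, sq_abs]
      nlinarith
    have hpow : T₀ ^ (2 * k) * ‖(ρ : ℂ)‖ ^ 2 ≤ 2 * T₀ ^ 2 * (|(ρ : ℂ).im| ^ k) ^ 2 := by
      have hk1 : 2 * k = 2 * (k - 1) + 2 := by omega
      have hTk : T₀ ^ (2 * (k - 1)) ≤ |(ρ : ℂ).im| ^ (2 * (k - 1)) :=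
        pow_le_pow_left₀ hT.le hγ.le _
      have e : (|(ρ : ℂ).im| ^ k) ^ 2 = |(ρ : ℂ).im| ^ (2 * (k - 1)) * |(ρ : ℂ).im| ^ 2 := by
        rw [← pow_mul, ← pow_add]; congr 1; omega
      rw [hk1, pow_add, e]
      have hT2 : 0 ≤ T₀ ^ 2 := sq_nonneg _
      calc T₀ ^ (2 * (k - 1)) * T₀ ^ 2 * ‖(ρ : ℂ)‖ ^ 2
          ≤ |(ρ : ℂ).im| ^ (2 * (k - 1)) * T₀ ^ 2 * (2 * |(ρ : ℂ).im| ^ 2) := by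
            apply mul_le_mul (mul_le_mul_of_nonneg_right hTk hT2) hnorm hρ0.le
            positivity
        _ = 2 * T₀ ^ 2 * (|(ρ : ℂ).im| ^ (2 * (k - 1)) * |(ρ : ℂ).im| ^ 2) := by ring
    have hfrac : L ^ 2 / (|(ρ : ℂ).im| ^ k) ^ 2 ≤
        2 * L ^ 2 * T₀ ^ 2 / T₀ ^ (2 * k) * (1 / ‖(ρ : ℂ)‖ ^ 2) := by
      rw [div_mul_div_comm, mul_one, div_le_div_iff₀ (by positivity) (by positivity)]
      calc L ^ 2 * (T₀ ^ (2 * k) * ‖(ρ : ℂ)‖ ^ 2)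
          ≤ L ^ 2 * (2 * T₀ ^ 2 * (|(ρ : ℂ).im| ^ k) ^ 2) :=
            mul_le_mul_of_nonneg_left hpow (sq_nonneg _)
        _ = 2 * L ^ 2 * T₀ ^ 2 * (|(ρ : ℂ).im| ^ k) ^ 2 := by ring
    calc (riemannZetaZeroOrder (ρ : ℂ) : ℝ) *
          ‖(weilMellin g ρ + weilMellin g (1 - conj (ρ : ℂ))) / 2‖ ^ 2
        ≤ (riemannZetaZeroOrder (ρ : ℂ) : ℝ) *
            (2 * L ^ 2 * T₀ ^ 2 / T₀ ^ (2 * k) * (1 / ‖(ρ : ℂ)‖ ^ 2)) :=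
          mul_le_mul_of_nonneg_left (hD2.trans hfrac) hm
      _ = _ := by ring

/-- **To every order**: if every non-trivial zero with `|Im ρ| ≤ T₀` (`T₀ ≥ 1`) lies on the line then
for every test function and every `k ≥ 1`,
`|Re Q(g) − ∑_{|Im ρ| ≤ T₀} m(ρ)‖ĝ(ρ)‖²| ≤ (463/5000) · L_k(g)² · T₀²/T₀^{2k}`. [folklore] -/
theorem abs_re_weilQuadratic_sub_verified_le_order {g : ℝ → ℂ} (hg : IsWeilTest g) {k : ℕ}
    (hk : 1 ≤ k) {T₀ : ℝ} (hT₀ : 1 ≤ T₀)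
    (hRH : ∀ ρ ∈ ZetaZeros.riemannZetaNontrivialZeros, |ρ.im| ≤ T₀ → ρ.re = 1 / 2) :
    |(weilQuadratic g).re -
        ∑' ρ : ZetaZeros.riemannZetaNontrivialZeros,
          (if |(ρ : ℂ).im| ≤ T₀ then (riemannZetaZeroOrder (ρ : ℂ) : ℝ) * ‖weilMellin g ρ‖ ^ 2
            else 0)| ≤
      463 / 5000 * weilL1 (deriv^[k] g) ^ 2 * T₀ ^ 2 / T₀ ^ (2 * k) := by
  have hsplit := re_weilQuadratic_eq_tsum_sub_tsum hg
  have hV := summable_verified hg T₀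
  have hL := summable_line hg
  set K : ℝ := 2 * weilL1 (deriv^[k] g) ^ 2 * T₀ ^ 2 / T₀ ^ (2 * k) with hK
  have hK0 : 0 ≤ K := div_nonneg (by positivity) (by positivity)
  have hF := FordL33.summable_order_div_norm_sq.mul_left K
  have hlow : ∑' ρ : ZetaZeros.riemannZetaNontrivialZeros,
      (if |(ρ : ℂ).im| ≤ T₀ then (riemannZetaZeroOrder (ρ : ℂ) : ℝ) * ‖weilMellin g ρ‖ ^ 2 else 0) ≤
      ∑' ρ : ZetaZeros.riemannZetaNontrivialZeros,
        (riemannZetaZeroOrder (ρ : ℂ) : ℝ) *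
          ‖(weilMellin g ρ + weilMellin g (1 - conj (ρ : ℂ))) / 2‖ ^ 2 :=
    hV.tsum_le_tsum (fun ρ ↦ (line_term_between_of_rh_upTo hg (by linarith) hRH ρ).1) hL
  have hup : ∑' ρ : ZetaZeros.riemannZetaNontrivialZeros,
        (riemannZetaZeroOrder (ρ : ℂ) : ℝ) *
          ‖(weilMellin g ρ + weilMellin g (1 - conj (ρ : ℂ))) / 2‖ ^ 2 ≤
      (∑' ρ : ZetaZeros.riemannZetaNontrivialZeros,
        (if |(ρ : ℂ).im| ≤ T₀ then (riemannZetaZeroOrder (ρ : ℂ) : ℝ) * ‖weilMellin g ρ‖ ^ 2 else 0)) +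
      K * ∑' ρ : ZetaZeros.riemannZetaNontrivialZeros,
          (riemannZetaZeroOrder (ρ : ℂ) : ℝ) / ‖(ρ : ℂ)‖ ^ 2 := by
    rw [← tsum_mul_left, ← hV.tsum_add hF]
    exact hL.tsum_le_tsum (fun ρ ↦ line_term_le_of_rh_upTo_order hg hk hT₀ hRH ρ) (hV.add hF)
  have hoff0 := tsum_offLine_nonneg g
  have hoff : ∑' ρ : ZetaZeros.riemannZetaNontrivialZeros,
        (riemannZetaZeroOrder (ρ : ℂ) : ℝ) *
          ‖(weilMellin g ρ - weilMellin g (1 - conj (ρ : ℂ))) / 2‖ ^ 2 ≤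
      K * ∑' ρ : ZetaZeros.riemannZetaNontrivialZeros,
          (riemannZetaZeroOrder (ρ : ℂ) : ℝ) / ‖(ρ : ℂ)‖ ^ 2 := by
    rw [← tsum_mul_left]
    exact (summable_offLine hg).tsum_le_tsum (offLine_term_le_of_rh_upTo_order hg hk hT₀ hRH) hF
  have h3 : ∑' ρ : ZetaZeros.riemannZetaNontrivialZeros,
      (riemannZetaZeroOrder (ρ : ℂ) : ℝ) / ‖(ρ : ℂ)‖ ^ 2 ≤ 0.0463 :=
    tsum_zeroOrder_div_norm_sq_le
  have h4 := mul_le_mul_of_nonneg_left h3 hK0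
  have h5 : K * 0.0463 = 463 / 5000 * weilL1 (deriv^[k] g) ^ 2 * T₀ ^ 2 / T₀ ^ (2 * k) := by
    rw [hK]; ring
  rw [hsplit, abs_le]
  constructor <;> linarith

end Summit.RiemannHypothesis.RiemannHypothesis.Theorems.WeilOffLine

end
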